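import Summits.Ventures.PercRepro.SixFourPLCov3C

/-!
# PercRepro — C-025 at `(6,4)`, step (4) of `PLJlow`, part D: Lemma `X̄′` (`#covPairsCL ≤ covNew`, PRECISION 3 (c)) and
the bound `≤ X̄′(π)` (mine-2; pre-cut of `SixFourPLCov3.lean` l.800–1009, bodies verbatim)

The step-(4) chain of record (`MINE2-RLS.md` §21.18.9.2, PRECISION 3) is `Xcnt M G ≤ Σ_{covPairs3} 2^{|P ∩ P′ ∩ G|} ≤
X̄(profile D)` (resp. `≤ X̄′(profile D)` at `g = 8, 9`), cut into gate-sized modules: `SixFourPLCovPairs3` (the first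
inequality, on the rank-3-trace planes; imports the landed `SixFourT4XA`) and `SixFourPLCov3A → SixFourPLCov3B →
SixFourPLCov3C → SixFourPLCov3D` (the second inequality as pure finite-set statements; `SixFourPLCov3A` imports the
landed `SixFourPLList`), joined by `SixFourPLSeam` (`Xcnt_le_Xbar_seam`, `Xcnt_le_Xbar'_seam`). The bodies are those of
lean-drafts/mine-2/SixFourPLCov3.lean (1,012 lines, sha16 54cf6c11e44bf06b) verbatim; only the preambles differ.

This part: the extra hypothesis bundle `PLTraceDataNew`, `card_mem_sizes`, `card_of_covered`, `card_fibre_le_covCoef`,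
`card_covPairsCL_le_covNew`, `sum_covPairsOf_tracesOf_le_Xbar'` and **`sum_covPairsOf_le_Xbar'_of_subset`** (the
`g = 8, 9` form of the second inequality). Imports `SixFourPLCov3C`.
-/

namespace PercRepro.SixFour

open Finset

variable {α : Type*} [DecidableEq α]

section accounting

variable {π : PL.CProf} {ρ L : Finset α} {C N : Finset (Finset α)}

/-! ## Lemma X̄′: `#covPairsCL ≤ covNew` (PRECISION 3 (c)) and the bound `≤ X̄′(π)` -/

/-- The extra facts for Lemma X̄′: the cap `s_j + 3 ≤ p` (so a covering line has `≥ 3` points), non-class line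
traces are proper subsets of `ρ`, at most `ν_m` non-class line traces of each size `m`, and in the meeting case
every class has `≥ 2` points (`λ_y ∋ y, z`). -/
structure PLTraceDataNew (π : PL.CProf) (ρ L : Finset α) (C N : Finset (Finset α)) : Prop where
  /-- the cap `s_j + 3 ≤ p` -/
  cap3 : ∀ A ∈ C, A.card + 3 ≤ ρ.card
  /-- a non-class line trace misses a point of `ρ` -/
  line_lt : ∀ l ∈ N, l.card + 1 ≤ ρ.card
  /-- at most `ν_m` non-class line traces of size `m` -/
  nu_count : ∀ m, (N.filter fun l => l.card = m).card ≤ PL.nu π m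
  /-- meeting case: every class has at least two points -/
  meet_two : π.meet = true → ∀ A ∈ C, 2 ≤ A.card

/-- A class `A ∈ C` is a size of `π`: `A.card ∈ π.sizes`. -/
theorem card_mem_sizes (h : PLTraceData π ρ L C N) {A : Finset α} (hA : A ∈ C) : A.card ∈ π.sizes := by
  have : A.card ∈ (π.sizes : Multiset ℕ) := by
    rw [h.sizes_eq, Multiset.mem_map]
    exact ⟨A, hA, rfl⟩
  exact Multiset.mem_coe.1 this

/-- A covered class `A` (`ρ ⊆ A ∪ λ`) is `(ρ ∖ λ) ∪ (A ∩ λ)` with `|A ∩ λ| ≤ 1`. -/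
theorem card_of_covered (h : PLTraceData π ρ L C N) {A : Finset α} (hA : A ∈ C) {l : Finset α} (hl : l ∈ N)
    (hcov : ρ ⊆ A ∪ l) : A.card = (ρ.card - l.card) + (A ∩ l).card ∧ (A ∩ l).card ≤ 1 := by
  have hsplit : A = (ρ \ l) ∪ (A ∩ l) := by
    ext y
    rw [Finset.mem_union, Finset.mem_sdiff, Finset.mem_inter]
    constructor
    · intro hy
      by_cases hyl : y ∈ l
      · exact Or.inr ⟨hy, hyl⟩
      · exact Or.inl ⟨h.class_subset A hA hy, hyl⟩
    · rintro (⟨hyρ, hyl⟩ | ⟨hy, -⟩)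
      · have := hcov hyρ
        rw [Finset.mem_union] at this
        exact this.resolve_right hyl
      · exact hy
  have hdisj' : Disjoint (ρ \ l) (A ∩ l) := by
    rw [Finset.disjoint_left]
    intro y hy hy'
    exact (Finset.mem_sdiff.1 hy).2 (Finset.mem_inter.1 hy').2
  refine ⟨?_, h.class_line A hA l hl⟩
  rw [← Finset.card_sdiff_of_subset (h.line_subset l hl)]
  conv_lhs => rw [hsplit]
  rw [Finset.card_union_of_disjoint hdisj']

/-- The fibre of `covPairsCL` over a non-class line trace `λ` is at most `c_{|λ|}` (PRECISION 3 (c), the case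
analysis `m ≤ p − 2` / `m = p − 1`, skew / meet). -/
theorem card_fibre_le_covCoef (h : PLTraceData π ρ L C N) (h' : PLTraceDataNew π ρ L C N) {l : Finset α}
    (hl : l ∈ N) : (C.filter fun A => ρ ⊆ A ∪ l).card ≤ PL.covCoef π l.card := by
  have hp := h.p_eq
  have hlt := h'.line_lt l hl
  have he : PL.e π ≤ 1 := by
    unfold PL.e
    split_ifs <;> omega
  -- two covered classes are equal when `|ρ ∖ λ| ≥ 2`
  have huniq : 2 ≤ ρ.card - l.card → (C.filter fun A => ρ ⊆ A ∪ l).card ≤ 1 := by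
    intro h2
    rw [Finset.card_le_one]
    intro A hA B hB
    rw [Finset.mem_filter] at hA hB
    by_contra hne
    have hsub : ρ \ l ⊆ A ∩ B := by
      intro y hy
      rw [Finset.mem_sdiff] at hy
      have h1 := hA.2 hy.1
      have h2 := hB.2 hy.1
      rw [Finset.mem_union] at h1 h2
      exact Finset.mem_inter.2 ⟨h1.resolve_right hy.2, h2.resolve_right hy.2⟩
    have := Finset.card_le_card hsub
    rw [Finset.card_sdiff_of_subset (h.line_subset l hl), h.class_class A hA.1 B hB.1 hne] at this
    omega
  unfold PL.covCoef
  by_cases hm1 : l.card + 1 = π.p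
  · rw [if_pos hm1]
    -- `|ρ ∖ λ| = 1`: a covered class has `≤ 2` points
    have hcov2 : ∀ A ∈ C, ρ ⊆ A ∪ l → A.card ≤ 2 := by
      intro A hA hcov
      have := card_of_covered h hA hl hcov
      omega
    by_cases hmeet : π.meet = true
    · rw [if_pos hmeet]
      calc (C.filter fun A => ρ ⊆ A ∪ l).card ≤ (C.filter fun A => A.card = 2).card := by
            apply Finset.card_le_card
            intro A hA
            rw [Finset.mem_filter] at hA ⊢
            have h2 := h'.meet_two hmeet A hA.1
            have h2' := hcov2 A hA.1 hA.2
            exact ⟨hA.1, by omega⟩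
        _ = π.sizes.count 2 := by
            rw [PL.card_filter_card_eq_list h.sizes_eq (fun a => a = 2), List.count_eq_countP,
              List.countP_eq_length_filter]
            rfl
    · rw [if_neg hmeet]
      -- skew: `e = 0`, classes are disjoint, so at most one class contains `y₀`
      have he0 : PL.e π = 0 := by
        unfold PL.e
        rw [if_neg hmeet]
      by_cases hany : π.sizes.any (fun s => s ≤ 2) = true
      · rw [if_pos hany, Finset.card_le_one]
        intro A hA B hB
        rw [Finset.mem_filter] at hA hB
        by_contra hne
        have hsub : ρ \ l ⊆ A ∩ B := by
          intro y hy
          rw [Finset.mem_sdiff] at hy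
          have h1 := hA.2 hy.1
          have h2 := hB.2 hy.1
          rw [Finset.mem_union] at h1 h2
          exact Finset.mem_inter.2 ⟨h1.resolve_right hy.2, h2.resolve_right hy.2⟩
        have h1 := Finset.card_le_card hsub
        rw [Finset.card_sdiff_of_subset (h.line_subset l hl), h.class_class A hA.1 B hB.1 hne, he0] at h1
        omega
      · rw [if_neg hany, Nat.le_zero, Finset.card_eq_zero, Finset.filter_eq_empty_iff]
        intro A hA hcov
        apply hany
        rw [List.any_eq_true]
        exact ⟨A.card, card_mem_sizes h hA, by simpa using hcov2 A hA hcov⟩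
  · rw [if_neg hm1]
    by_cases hany : π.sizes.any (fun s => s + l.card = π.p ∨ s + l.card = π.p + 1) = true
    · rw [if_pos hany]
      exact huniq (by omega)
    · rw [if_neg hany, Nat.le_zero, Finset.card_eq_zero, Finset.filter_eq_empty_iff]
      intro A hA hcov
      apply hany
      rw [List.any_eq_true]
      refine ⟨A.card, card_mem_sizes h hA, ?_⟩
      have := card_of_covered h hA hl hcov
      have hc3 := h'.cap3 A hA
      simp only [decide_eq_true_eq]
      omega

/-- **Lemma X̄′ (PRECISION 3 (c))**: `#covPairsCL ≤ covNew π`. -/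
theorem card_covPairsCL_le_covNew (h : PLTraceData π ρ L C N) (h' : PLTraceDataNew π ρ L C N) :
    (covPairsCL ρ C N).card ≤ PL.covNew π := by
  rw [card_covPairsCL_eq_sum']
  calc ∑ l ∈ N, (C.filter fun A => ρ ⊆ A ∪ l).card
      ≤ ∑ l ∈ N, ∑ i ∈ Finset.range (π.p - 3), (if l.card = i + 3 then PL.covCoef π (i + 3) else 0) := by
        apply Finset.sum_le_sum
        intro l hl
        have hlt := h'.line_lt l hl
        have hp := h.p_eq
        by_cases h3 : 3 ≤ l.card
        · rw [Finset.sum_eq_single (l.card - 3)]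
          · rw [if_pos (by omega), show l.card - 3 + 3 = l.card by omega]
            exact card_fibre_le_covCoef h h' hl
          · intro i _ hi
            rw [if_neg (by omega)]
          · intro hi
            rw [Finset.mem_range] at hi
            omega
        · -- `|λ| ≤ 2`: no covered class (the cap)
          have : (C.filter fun A => ρ ⊆ A ∪ l).card = 0 := by
            rw [Finset.card_eq_zero, Finset.filter_eq_empty_iff]
            intro A hA hcov
            have := card_of_covered h hA hl hcov
            have hc3 := h'.cap3 A hA
            omega
          rw [this]
          exact Nat.zero_le _
    _ = ∑ i ∈ Finset.range (π.p - 3), PL.covCoef π (i + 3) * (N.filter fun l => l.card = i + 3).card := by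
        rw [Finset.sum_comm]
        apply Finset.sum_congr rfl
        intro i _
        rw [Finset.card_filter, Finset.mul_sum]
        apply Finset.sum_congr rfl
        intro l _
        rw [mul_boole]
    _ ≤ ∑ i ∈ Finset.range (π.p - 3), PL.nu π (i + 3) * PL.covCoef π (i + 3) := by
        apply Finset.sum_le_sum
        intro i _
        rw [Nat.mul_comm]
        exact Nat.mul_le_mul_right _ (h'.nu_count (i + 3))
    _ = PL.covNew π := by
        unfold PL.covNew
        rw [PL.list_sum_range]

/-- **Step (4) with Lemma X̄′**: on the listed traces the covering-pair sum is at most `X̄′(π)`. -/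
theorem sum_covPairsOf_tracesOf_le_Xbar' (h : PLTraceData π ρ L C N) (h' : PLTraceDataNew π ρ L C N) :
    ∑ pp ∈ covPairsOf (tracesOf ρ L C N) (ρ ∪ L), 2 ^ (pp.1 ∩ pp.2).card ≤ PL.Xbar' π := by
  rw [sum_covPairsOf_eq]
  unfold tracesOf
  have hρ := rho_notMem h
  have hAB := disjoint_piTraces_xlTraces h
  simp only [Finset.sum_insert hρ, Finset.sum_union hAB, Finset.sum_add_distrib]
  rw [cw_rho_rho, sum_rho_pi h, sum_rho_xl h, sum_pi_rho h, sum_pi_pi h, sum_xl_rho h, sum_xl_xl h]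
  have h1 := sum_pi_xl_le_cov h
  have h2 := sum_xl_pi_le_cov h
  have hmin : (covPairsCL ρ C N).card ≤ min (PL.covOld π) (PL.covNew π) := by
    apply le_min _ (card_covPairsCL_le_covNew h h')
    unfold PL.covOld
    rw [← PL.card_filter_card_eq_list h.sizes_eq (fun s => 0 < PL.nu π (π.p - s) ∨ 0 < PL.nu π (π.p - s + 1))]
    exact card_covPairsCL_le_covOld h
  have h3 : 4 * L.card * (covPairsCL ρ C N).card ≤ 4 * L.card * min (PL.covOld π) (PL.covNew π) :=
    Nat.mul_le_mul_left _ hmin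
  have e1 : (π.sizes.map fun s => 2 ^ s).sum = ∑ A ∈ C, 2 ^ A.card :=
    (PL.sum_card_eq_list h.sizes_eq (fun s => 2 ^ s)).symm
  unfold PL.Xbar' PL.lprime
  rw [e1, h.n_eq]
  omega

/-- **Step (4) composed, with Lemma X̄′**: the `g = 8, 9` form. -/
theorem sum_covPairsOf_le_Xbar'_of_subset (h : PLTraceData π ρ L C N) (h' : PLTraceDataNew π ρ L C N)
    {S : Finset (Finset α)} (hinj : Set.InjOn (fun P : Finset α => P ∩ (ρ ∪ L)) S)
    (hsub : (S.image fun P => P ∩ (ρ ∪ L)) ⊆ tracesOf ρ L C N) :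
    ∑ pp ∈ covPairsOf S (ρ ∪ L), 2 ^ (pp.1 ∩ pp.2 ∩ (ρ ∪ L)).card ≤ PL.Xbar' π := by
  rw [sum_covPairsOf_image_inter hinj]
  exact (sum_covPairsOf_mono hsub (ρ ∪ L)).trans (sum_covPairsOf_tracesOf_le_Xbar' h h')


end accounting

end PercRepro.SixFour
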